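import Literature.NumberTheory.Irrationality.KrattenthalerZudilin2019.CatalanRTildeTelescopeProofs
import Literature.NumberTheory.Irrationality.KrattenthalerZudilin2019.CatalanRTildeBoundsProofs
import Literature.NumberTheory.Irrationality.Zudilin2003.CatalanSeries
import Literature.NumberTheory.Irrationality.Zudilin2003.CatalanTwoAdic
import HarnessLib

/-!
# Krattenthaler–Zudilin 2019, §2: `r_n = r̃_n` and `2^{4n} d_{2n−1}² r̃_n ∈ ℤ + ℤG` — PROVED

Proofs-only companion (file 3 of 3) of `ZetaOddMinusPiPowers.lean`: it DISCHARGES the two named facts of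
[KrattenthalerZudilin2019, §2] about the very-well-poised `₆F₅(1)` family `r̃_n` (`catalanRTilde`),
* `catalanR_eq_catalanRTilde_holds : catalanR_eq_catalanRTilde` — "Amazingly, we have `r_n = r̃_n`" (in print a
  case of their Theorem 2), and
* `catalanRTilde_integrality_holds : catalanRTilde_integrality` — `2^{4n} d_{2n−1}² r̃_n ∈ ℤ + ℤG`, asserted in
  print WITHOUT proof ("it is reasonably easy to show … using an argument similar to the one in [Zu02b]"),
by the route of the cell `pub-zeta5` (seat denom-engine-d2): both sides equal `(−1)ⁿ·8·(u_nG − v_n)` where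
`u_n, v_n` solve Zudilin's recursion (2) of [Zudilin2003Catalan] (`Zudilin2003.form n = u_nG − v_n`).
* `r_n` side (`catalanR_eq_neg_one_pow_mul_F`): the summand of `catalanR n` is `(−1)^{n+t}R_n(t)` for Zudilin's
  very-well-poised summand `Zudilin2003.R`, so `r_n = (−1)ⁿF_n` with `F_n = Σ_t(−1)^tR_n(t) = 8(u_nG − v_n)`
  (tree: `Zudilin2003.hasSum_F'`, `Zudilin2003.F_eq_form`).
* `r̃_n` side (`catalanRTilde_eq_neg_one_pow_mul_F`): summing the creative-telescoping identity of file 1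
  (`CatalanRTilde.telescope_succ_pointwise`) over `u` — every series converges by the majorant
  `a_n(u) ≤ 4(2n+1)!/(2u+1)²` of file 2, the boundary terms are `V_m(0) = 0` and `V_m(u) → 0`
  (`CatalanRTilde.certificate_tendsto_zero`) — shows that `y_n := (−1)ⁿr̃_n` satisfies the same recursion as
  `F_n` (`Zudilin2003.F_rec`); the initial values are `y_0 = r̃_0 = 8G = F_0` (tree: `catalanRTilde_zero`) and
  `y_1 = −r̃_1 = 14G − 13 = F_1`, where `r̃_1 = 13 − 14G` is PROVED from the `n = 0` companion identity
  (`CatalanRTilde.telescope_zero_pointwise`, boundary value `13`); two-step induction gives `y_n = F_n`.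
* Integrality: with `r̃_n = (−1)ⁿ·8·(u_nG − v_n)`, the tree's PROVED `Zudilin2003.TwoAdic.zudilin_observation`
  (`2^{4n}u_n ∈ ℤ`, `2^{4n}D²_{2n−1}v_n ∈ ℤ`, `D_N = Nat.lcmUpto N`) gives integers `A = −(−1)ⁿ·8·(2^{4n}D²v_n)`,
  `B = (−1)ⁿ·8·D²·(2^{4n}u_n)` with `2^{4n}D²_{2n−1}r̃_n = A + B·G`, exactly the statement's form.
HONEST FRAMING (cell pub-zeta5): systematic search; an identity and a denominator statement for a KNOWN sequence of
rational approximations to Catalan's constant `G` (not known to be irrational; as the Zudilin files record,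
`4 log 2 + 4 > 2·2.406…`, so nothing diophantine follows).  Theorems only (no definitions); statement file untouched.
-/

open Finset Filter
open scoped Nat Topology

namespace Literature.NumberTheory.Irrationality.KrattenthalerZudilin2019

open Literature.NumberTheory.Transcendental (catalanConstant)
open Literature.NumberTheory.Irrationality.Zudilin2003 (p q form F F_eq_form hasSum_F' F_rec p_pos)

namespace CatalanRTilde

/-! ### Summability of the `r̃_n` series -/

/-- `Σ_u 1/(u+1)²` converges. [folklore] -/
private theorem summable_one_div_succ_sq : Summable (fun u : ℕ => 1 / ((u : ℝ) + 1) ^ 2) := by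
  simpa using (summable_nat_add_iff 1).2 (Real.summable_one_div_nat_pow.2 one_lt_two)

/-- `catalanRTilde n = 2^{2n+2} Σ_u a_n(u)` (the definition, unfolded). [cite: KrattenthalerZudilin2019, §2 (second display)] -/
private theorem catalanRTilde_eq_tsum (n : ℕ) :
    catalanRTilde n = 2 ^ (2 * (n + 1)) * ∑' u : ℕ, (2 * (u : ℝ) + 1) * ((2 * n + 1)! : ℝ) * (∏ j ∈ range (2 * n), ((u : ℝ) + 1 - n + j))
            / ∏ j ∈ range (2 * n + 2), (2 * (u : ℝ) - n + 1 / 2 + j) ^ 2 := by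
  rw [catalanRTilde]

/-- The series `Σ_u a_n(u)` of `r̃_n` converges (majorant `4(2n+1)!/(2u+1)² ≤ 4(2n+1)!/(u+1)²`, file 2).
[cite: KrattenthalerZudilin2019, §2 (second display)] -/
private theorem hasSum_summand (n : ℕ) :
    HasSum (fun u : ℕ => (2 * (u : ℝ) + 1) * ((2 * n + 1)! : ℝ) * (∏ j ∈ range (2 * n), ((u : ℝ) + 1 - n + j))
            / ∏ j ∈ range (2 * n + 2), (2 * (u : ℝ) - n + 1 / 2 + j) ^ 2)
      (∑' u : ℕ, (2 * (u : ℝ) + 1) * ((2 * n + 1)! : ℝ) * (∏ j ∈ range (2 * n), ((u : ℝ) + 1 - n + j))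
            / ∏ j ∈ range (2 * n + 2), (2 * (u : ℝ) - n + 1 / 2 + j) ^ 2) := by
  refine (Summable.of_nonneg_of_le (fun u => summand_nonneg n u) (fun u => (summand_le n u).trans ?_)
    (summable_one_div_succ_sq.mul_left (4 * ((2 * n + 1)! : ℝ)))).hasSum
  rw [div_eq_mul_one_div]
  gcongr
  linarith [(Nat.cast_nonneg u : (0 : ℝ) ≤ u)]

/-! ### `(−1)ⁿ r̃_n` satisfies Zudilin's recursion (2) -/

/-- Summing the creative-telescoping identity of file 1 over `u ≥ 0`: for every `m`,
`c₊·(−1)^{m+2}r̃_{m+2} − q(m+1)·(−1)^{m+1}r̃_{m+1} − c₋·(−1)^m r̃_m = 0` with the coefficients of `Zudilin2003.F_rec`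
(the boundary terms are `V_m(0) = 0` and `V_m(u) → 0`). [cite: Zudilin2003Catalan, Sect. 1, eq. (2)] -/
private theorem neg_one_pow_mul_catalanRTilde_rec (m : ℕ) :
    (2 * ((m : ℝ) + 1) + 1) ^ 2 * (2 * ((m : ℝ) + 1) + 2) ^ 2 * ((p ((m : ℚ) + 1) : ℚ) : ℝ)
        * ((-1 : ℝ) ^ (m + 2) * catalanRTilde (m + 2))
      - ((q ((m : ℚ) + 1) : ℚ) : ℝ) * ((-1 : ℝ) ^ (m + 1) * catalanRTilde (m + 1))
      - (2 * ((m : ℝ) + 1) - 1) ^ 2 * (2 * ((m : ℝ) + 1)) ^ 2 * ((p ((m : ℚ) + 1 + 1) : ℚ) : ℝ)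
        * ((-1 : ℝ) ^ m * catalanRTilde m) = 0 := by
  set cp : ℝ := (2 * ((m : ℝ) + 1) + 1) ^ 2 * (2 * ((m : ℝ) + 1) + 2) ^ 2 * ((p ((m : ℚ) + 1) : ℚ) : ℝ)
    with hcp
  set cq : ℝ := ((q ((m : ℚ) + 1) : ℚ) : ℝ) with hcq
  set cm : ℝ := (2 * ((m : ℝ) + 1) - 1) ^ 2 * (2 * ((m : ℝ) + 1)) ^ 2 * ((p ((m : ℚ) + 1 + 1) : ℚ) : ℝ)
    with hcm
  have h2 := hasSum_summand (m + 2)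
  have h1 := hasSum_summand (m + 1)
  have h0 := hasSum_summand m
  set A2 : ℝ := ∑' u : ℕ, (2 * (u : ℝ) + 1) * ((2 * (m + 2) + 1)! : ℝ) * (∏ j ∈ range (2 * (m + 2)), ((u : ℝ) + 1 - ((m + 2 : ℕ) : ℝ) + j))
            / ∏ j ∈ range (2 * (m + 2) + 2), (2 * (u : ℝ) - ((m + 2 : ℕ) : ℝ) + 1 / 2 + j) ^ 2 with hA2
  set A1 : ℝ := ∑' u : ℕ, (2 * (u : ℝ) + 1) * ((2 * (m + 1) + 1)! : ℝ) * (∏ j ∈ range (2 * (m + 1)), ((u : ℝ) + 1 - ((m + 1 : ℕ) : ℝ) + j))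
            / ∏ j ∈ range (2 * (m + 1) + 2), (2 * (u : ℝ) - ((m + 1 : ℕ) : ℝ) + 1 / 2 + j) ^ 2 with hA1
  set A0 : ℝ := ∑' u : ℕ, (2 * (u : ℝ) + 1) * ((2 * m + 1)! : ℝ) * (∏ j ∈ range (2 * m), ((u : ℝ) + 1 - (m : ℝ) + j))
            / ∏ j ∈ range (2 * m + 2), (2 * (u : ℝ) - (m : ℝ) + 1 / 2 + j) ^ 2 with hA0
  set V : ℕ → ℝ := (fun v : ℕ => ((2 * m + 2)! : ℝ) * (v : ℝ)
          * ((13 - 20 * ((m : ℝ) + 1) - 1632 * ((m : ℝ) + 1) ^ 2 + 976 * ((m : ℝ) + 1) ^ 3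
                + 23520 * ((m : ℝ) + 1) ^ 4 + 3392 * ((m : ℝ) + 1) ^ 5 - 141824 * ((m : ℝ) + 1) ^ 6
                - 224512 * ((m : ℝ) + 1) ^ 7 - 101120 * ((m : ℝ) + 1) ^ 8)
              + (640 + 512 * ((m : ℝ) + 1) + 768 * ((m : ℝ) + 1) ^ 2 - 37888 * ((m : ℝ) + 1) ^ 3
                + 49152 * ((m : ℝ) + 1) ^ 4 + 299008 * ((m : ℝ) + 1) ^ 5
                + 225280 * ((m : ℝ) + 1) ^ 6) * (v : ℝ) ^ 2
              + (-3328 + 5120 * ((m : ℝ) + 1) + 14336 * ((m : ℝ) + 1) ^ 2 - 12288 * ((m : ℝ) + 1) ^ 3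
                - 20480 * ((m : ℝ) + 1) ^ 4) * (v : ℝ) ^ 4)
          * (∏ i ∈ range (2 * m + 1), ((v : ℝ) - m + i))
          / ((2 * (v : ℝ) - m - 3 / 2) ^ 2
              * ∏ j ∈ range (2 * m + 3), (2 * (v : ℝ) - m - 1 / 2 + j) ^ 2)) with hV
  -- the summed identity
  have hΛ : HasSum (fun u : ℕ =>
      128 * cp * ((2 * (u : ℝ) + 1) * ((2 * (m + 2) + 1)! : ℝ) * (∏ j ∈ range (2 * (m + 2)), ((u : ℝ) + 1 - ((m + 2 : ℕ) : ℝ) + j))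
            / ∏ j ∈ range (2 * (m + 2) + 2), (2 * (u : ℝ) - ((m + 2 : ℕ) : ℝ) + 1 / 2 + j) ^ 2)
      + 32 * cq * ((2 * (u : ℝ) + 1) * ((2 * (m + 1) + 1)! : ℝ) * (∏ j ∈ range (2 * (m + 1)), ((u : ℝ) + 1 - ((m + 1 : ℕ) : ℝ) + j))
            / ∏ j ∈ range (2 * (m + 1) + 2), (2 * (u : ℝ) - ((m + 1 : ℕ) : ℝ) + 1 / 2 + j) ^ 2)
      - 8 * cm * ((2 * (u : ℝ) + 1) * ((2 * m + 1)! : ℝ) * (∏ j ∈ range (2 * m), ((u : ℝ) + 1 - (m : ℝ) + j))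
            / ∏ j ∈ range (2 * m + 2), (2 * (u : ℝ) - (m : ℝ) + 1 / 2 + j) ^ 2)) (128 * cp * A2 + 32 * cq * A1 - 8 * cm * A0) :=
    ((h2.mul_left (128 * cp)).add (h1.mul_left (32 * cq))).sub (h0.mul_left (8 * cm))
  have hpt : ∀ u : ℕ,
      128 * cp * ((2 * (u : ℝ) + 1) * ((2 * (m + 2) + 1)! : ℝ) * (∏ j ∈ range (2 * (m + 2)), ((u : ℝ) + 1 - ((m + 2 : ℕ) : ℝ) + j))
            / ∏ j ∈ range (2 * (m + 2) + 2), (2 * (u : ℝ) - ((m + 2 : ℕ) : ℝ) + 1 / 2 + j) ^ 2)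
      + 32 * cq * ((2 * (u : ℝ) + 1) * ((2 * (m + 1) + 1)! : ℝ) * (∏ j ∈ range (2 * (m + 1)), ((u : ℝ) + 1 - ((m + 1 : ℕ) : ℝ) + j))
            / ∏ j ∈ range (2 * (m + 1) + 2), (2 * (u : ℝ) - ((m + 1 : ℕ) : ℝ) + 1 / 2 + j) ^ 2)
      - 8 * cm * ((2 * (u : ℝ) + 1) * ((2 * m + 1)! : ℝ) * (∏ j ∈ range (2 * m), ((u : ℝ) + 1 - (m : ℝ) + j))
            / ∏ j ∈ range (2 * m + 2), (2 * (u : ℝ) - (m : ℝ) + 1 / 2 + j) ^ 2) = V u - V (u + 1) := fun u => by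
    rw [hV, hcp, hcq, hcm]
    exact telescope_succ_pointwise m u
  have hV0 : V 0 = 0 := by simp [hV]
  have hpart : ∀ M : ℕ, ∑ u ∈ range M,
      (128 * cp * ((2 * (u : ℝ) + 1) * ((2 * (m + 2) + 1)! : ℝ) * (∏ j ∈ range (2 * (m + 2)), ((u : ℝ) + 1 - ((m + 2 : ℕ) : ℝ) + j))
            / ∏ j ∈ range (2 * (m + 2) + 2), (2 * (u : ℝ) - ((m + 2 : ℕ) : ℝ) + 1 / 2 + j) ^ 2)
      + 32 * cq * ((2 * (u : ℝ) + 1) * ((2 * (m + 1) + 1)! : ℝ) * (∏ j ∈ range (2 * (m + 1)), ((u : ℝ) + 1 - ((m + 1 : ℕ) : ℝ) + j))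
            / ∏ j ∈ range (2 * (m + 1) + 2), (2 * (u : ℝ) - ((m + 1 : ℕ) : ℝ) + 1 / 2 + j) ^ 2)
      - 8 * cm * ((2 * (u : ℝ) + 1) * ((2 * m + 1)! : ℝ) * (∏ j ∈ range (2 * m), ((u : ℝ) + 1 - (m : ℝ) + j))
            / ∏ j ∈ range (2 * m + 2), (2 * (u : ℝ) - (m : ℝ) + 1 / 2 + j) ^ 2)) = V 0 - V M := fun M => by
    rw [sum_congr rfl fun u _ => hpt u, Finset.sum_range_sub']
  have hVt : Tendsto V atTop (𝓝 0) := by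
    rw [hV]
    exact certificate_tendsto_zero m
  have hlim : Tendsto (fun M : ℕ => ∑ u ∈ range M,
      (128 * cp * ((2 * (u : ℝ) + 1) * ((2 * (m + 2) + 1)! : ℝ) * (∏ j ∈ range (2 * (m + 2)), ((u : ℝ) + 1 - ((m + 2 : ℕ) : ℝ) + j))
            / ∏ j ∈ range (2 * (m + 2) + 2), (2 * (u : ℝ) - ((m + 2 : ℕ) : ℝ) + 1 / 2 + j) ^ 2)
      + 32 * cq * ((2 * (u : ℝ) + 1) * ((2 * (m + 1) + 1)! : ℝ) * (∏ j ∈ range (2 * (m + 1)), ((u : ℝ) + 1 - ((m + 1 : ℕ) : ℝ) + j))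
            / ∏ j ∈ range (2 * (m + 1) + 2), (2 * (u : ℝ) - ((m + 1 : ℕ) : ℝ) + 1 / 2 + j) ^ 2)
      - 8 * cm * ((2 * (u : ℝ) + 1) * ((2 * m + 1)! : ℝ) * (∏ j ∈ range (2 * m), ((u : ℝ) + 1 - (m : ℝ) + j))
            / ∏ j ∈ range (2 * m + 2), (2 * (u : ℝ) - (m : ℝ) + 1 / 2 + j) ^ 2))) atTop (𝓝 (V 0 - 0)) := by
    simp_rw [hpart]
    exact tendsto_const_nhds.sub hVt
  have hsum : 128 * cp * A2 + 32 * cq * A1 - 8 * cm * A0 = 0 := by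
    have := tendsto_nhds_unique hΛ.tendsto_sum_nat hlim
    rw [this, hV0, sub_zero]
  rw [catalanRTilde_eq_tsum (m + 2), catalanRTilde_eq_tsum (m + 1), catalanRTilde_eq_tsum m, ← hA2, ← hA1, ← hA0]
  linear_combination ((-1 : ℝ) ^ m * 2 ^ (2 * m + 2) / 8) * hsum

/-! ### The initial values `r̃_0 = 8G`, `r̃_1 = 13 − 14G` -/

/-- `r̃_1 = 13 − 14G`, PROVED from the `n = 0` companion identity of file 1 (boundary value `13`) and
`r̃_0 = 8G` (`catalanRTilde_zero`). [cite: KrattenthalerZudilin2019, §2 (second display)] -/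
theorem catalanRTilde_one : catalanRTilde 1 = 13 - 14 * catalanConstant := by
  have h1 := hasSum_summand 1
  have h0 := hasSum_summand 0
  set S1 : ℝ := ∑' u : ℕ, (2 * (u : ℝ) + 1) * ((2 * 1 + 1)! : ℝ) * (∏ j ∈ range (2 * 1), ((u : ℝ) + 1 - ((1 : ℕ) : ℝ) + j))
            / ∏ j ∈ range (2 * 1 + 2), (2 * (u : ℝ) - ((1 : ℕ) : ℝ) + 1 / 2 + j) ^ 2 with hS1
  set S0 : ℝ := ∑' u : ℕ, (2 * (u : ℝ) + 1) * ((2 * 0 + 1)! : ℝ) * (∏ j ∈ range (2 * 0), ((u : ℝ) + 1 - ((0 : ℕ) : ℝ) + j))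
            / ∏ j ∈ range (2 * 0 + 2), (2 * (u : ℝ) - ((0 : ℕ) : ℝ) + 1 / 2 + j) ^ 2 with hS0
  have hc1 : catalanRTilde 1 = 16 * S1 := by rw [catalanRTilde_eq_tsum 1, ← hS1]; norm_num
  have hc0 : catalanRTilde 0 = 4 * S0 := by rw [catalanRTilde_eq_tsum 0, ← hS0]; norm_num
  have hS0G : S0 = 2 * catalanConstant := by
    have := catalanRTilde_zero
    rw [hc0] at this
    linarith
  -- the two summands in the simplified form of `telescope_zero_pointwise`
  have e1 : ∀ u : ℕ, (2 * (u : ℝ) + 1) * ((2 * 1 + 1)! : ℝ) * (∏ j ∈ range (2 * 1), ((u : ℝ) + 1 - ((1 : ℕ) : ℝ) + j))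
            / ∏ j ∈ range (2 * 1 + 2), (2 * (u : ℝ) - ((1 : ℕ) : ℝ) + 1 / 2 + j) ^ 2
      = (2 * (u : ℝ) + 1) * 6 * ((u : ℝ) * ((u : ℝ) + 1))
          / ((2 * (u : ℝ) - 1 / 2) ^ 2 * (2 * (u : ℝ) + 1 / 2) ^ 2 * (2 * (u : ℝ) + 3 / 2) ^ 2
              * (2 * (u : ℝ) + 5 / 2) ^ 2) := fun u => by
    simp only [prod_range_succ, prod_range_zero, Nat.factorial, Nat.succ_eq_add_one]
    push_cast
    ring
  have e0 : ∀ u : ℕ, (2 * (u : ℝ) + 1) * ((2 * 0 + 1)! : ℝ) * (∏ j ∈ range (2 * 0), ((u : ℝ) + 1 - ((0 : ℕ) : ℝ) + j))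
            / ∏ j ∈ range (2 * 0 + 2), (2 * (u : ℝ) - ((0 : ℕ) : ℝ) + 1 / 2 + j) ^ 2
      = (2 * (u : ℝ) + 1) / ((2 * (u : ℝ) + 1 / 2) ^ 2 * (2 * (u : ℝ) + 3 / 2) ^ 2) := fun u => by
    simp only [prod_range_succ, prod_range_zero, Nat.factorial, Nat.succ_eq_add_one]
    push_cast
    ring
  set W : ℕ → ℝ := (fun v : ℕ => 2 * (14 * (v : ℝ) ^ 4 + 21 * (v : ℝ) ^ 3 + 19 / 2 * (v : ℝ) ^ 2 + 39 / 16 * (v : ℝ)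
            + 117 / 128)
          / ((2 * (v : ℝ) - 1 / 2) ^ 2 * (2 * (v : ℝ) + 1 / 2) ^ 2 * (2 * (v : ℝ) + 3 / 2) ^ 2)) with hW
  have hΛ : HasSum (fun u : ℕ =>
      16 * ((2 * (u : ℝ) + 1) * 6 * ((u : ℝ) * ((u : ℝ) + 1))
          / ((2 * (u : ℝ) - 1 / 2) ^ 2 * (2 * (u : ℝ) + 1 / 2) ^ 2 * (2 * (u : ℝ) + 3 / 2) ^ 2
              * (2 * (u : ℝ) + 5 / 2) ^ 2))
      + 7 * ((2 * (u : ℝ) + 1) / ((2 * (u : ℝ) + 1 / 2) ^ 2 * (2 * (u : ℝ) + 3 / 2) ^ 2)))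
      (16 * S1 + 7 * S0) :=
    ((h1.congr_fun fun u => (e1 u).symm).mul_left 16).add ((h0.congr_fun fun u => (e0 u).symm).mul_left 7)
  have hpt : ∀ u : ℕ,
      16 * ((2 * (u : ℝ) + 1) * 6 * ((u : ℝ) * ((u : ℝ) + 1))
          / ((2 * (u : ℝ) - 1 / 2) ^ 2 * (2 * (u : ℝ) + 1 / 2) ^ 2 * (2 * (u : ℝ) + 3 / 2) ^ 2
              * (2 * (u : ℝ) + 5 / 2) ^ 2))
      + 7 * ((2 * (u : ℝ) + 1) / ((2 * (u : ℝ) + 1 / 2) ^ 2 * (2 * (u : ℝ) + 3 / 2) ^ 2))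
      = W u - W (u + 1) := fun u => by
    rw [hW]
    exact telescope_zero_pointwise u
  have hW0 : W 0 = 13 := by rw [hW]; norm_num
  have hWt : Tendsto W atTop (𝓝 0) := by
    rw [hW]
    exact certificate_zero_tendsto_zero
  have hlim : Tendsto (fun M : ℕ => ∑ u ∈ range M,
      (16 * ((2 * (u : ℝ) + 1) * 6 * ((u : ℝ) * ((u : ℝ) + 1))
          / ((2 * (u : ℝ) - 1 / 2) ^ 2 * (2 * (u : ℝ) + 1 / 2) ^ 2 * (2 * (u : ℝ) + 3 / 2) ^ 2
              * (2 * (u : ℝ) + 5 / 2) ^ 2))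
      + 7 * ((2 * (u : ℝ) + 1) / ((2 * (u : ℝ) + 1 / 2) ^ 2 * (2 * (u : ℝ) + 3 / 2) ^ 2))))
      atTop (𝓝 (W 0 - 0)) := by
    have hpart : ∀ M : ℕ, ∑ u ∈ range M,
        (16 * ((2 * (u : ℝ) + 1) * 6 * ((u : ℝ) * ((u : ℝ) + 1))
            / ((2 * (u : ℝ) - 1 / 2) ^ 2 * (2 * (u : ℝ) + 1 / 2) ^ 2 * (2 * (u : ℝ) + 3 / 2) ^ 2
                * (2 * (u : ℝ) + 5 / 2) ^ 2))
        + 7 * ((2 * (u : ℝ) + 1) / ((2 * (u : ℝ) + 1 / 2) ^ 2 * (2 * (u : ℝ) + 3 / 2) ^ 2)))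
        = W 0 - W M := fun M => by
      rw [sum_congr rfl fun u _ => hpt u, Finset.sum_range_sub']
    simp_rw [hpart]
    exact tendsto_const_nhds.sub hWt
  have hsum : 16 * S1 + 7 * S0 = 13 := by
    have := tendsto_nhds_unique hΛ.tendsto_sum_nat hlim
    rw [this, hW0, sub_zero]
  rw [hc1]
  linarith

/-! ### Identification with Zudilin's `F_n = 8(u_nG − v_n)` -/

/-- **`(−1)ⁿ r̃_n = F_n = 8(u_nG − v_n)`** for every `n`: same second-order recursion (`Zudilin2003.F_rec` and
`neg_one_pow_mul_catalanRTilde_rec`, leading coefficient `> 0`) and same two initial values.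
[cite: KrattenthalerZudilin2019, §2 (second display)] -/
theorem neg_one_pow_mul_catalanRTilde_eq_F (n : ℕ) : (-1 : ℝ) ^ n * catalanRTilde n = F n := by
  induction n using Nat.strong_induction_on with
  | _ n ih =>
    match n with
    | 0 =>
      rw [pow_zero, one_mul, catalanRTilde_zero, F_eq_form]
      norm_num [form, Zudilin2003.u, Zudilin2003.v]
    | 1 =>
      rw [pow_one, catalanRTilde_one, F_eq_form]
      norm_num [form, Zudilin2003.u, Zudilin2003.v]
      ring
    | m + 2 =>
      have hy := neg_one_pow_mul_catalanRTilde_rec m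
      have hF := F_rec m
      rw [ih m (by omega), ih (m + 1) (by omega)] at hy
      have hcp : 0 < (2 * ((m : ℝ) + 1) + 1) ^ 2 * (2 * ((m : ℝ) + 1) + 2) ^ 2 * ((p ((m : ℚ) + 1) : ℚ) : ℝ) := by
        have : (0 : ℝ) < ((p ((m : ℚ) + 1) : ℚ) : ℝ) := by exact_mod_cast p_pos _
        positivity
      have h : (2 * ((m : ℝ) + 1) + 1) ^ 2 * (2 * ((m : ℝ) + 1) + 2) ^ 2 * ((p ((m : ℚ) + 1) : ℚ) : ℝ)
          * ((-1 : ℝ) ^ (m + 2) * catalanRTilde (m + 2) - F (m + 2)) = 0 := by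
        linear_combination hy - hF
      rcases mul_eq_zero.mp h with h | h
      · exact absurd h hcp.ne'
      · exact sub_eq_zero.mp h

/-- **`r̃_n = (−1)ⁿ·8·(u_nG − v_n)`** (`Zudilin2003.form n = u_nG − v_n`). [cite: KrattenthalerZudilin2019, §2 (second display)] -/
theorem catalanRTilde_eq_form (n : ℕ) : catalanRTilde n = (-1 : ℝ) ^ n * (8 * form n) := by
  have h := neg_one_pow_mul_catalanRTilde_eq_F n
  rw [F_eq_form] at h
  have h1 : ((-1 : ℝ) ^ n) ^ 2 = 1 := by rw [← pow_mul, mul_comm, pow_mul, neg_one_sq, one_pow]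
  calc catalanRTilde n = ((-1 : ℝ) ^ n) ^ 2 * catalanRTilde n := by rw [h1, one_mul]
    _ = (-1 : ℝ) ^ n * ((-1 : ℝ) ^ n * catalanRTilde n) := by ring
    _ = (-1 : ℝ) ^ n * (8 * form n) := by rw [h]

/-- **`r_n = (−1)ⁿ·8·(u_nG − v_n)`**: the summand of `catalanR n` is `(−1)^{n+t}` times Zudilin's very-well-poised
summand `R_n(t)` (7) of [Zudilin2003Catalan], whose series is `F_n = 8(u_nG − v_n)` in the tree
(`Zudilin2003.hasSum_F'`, `Zudilin2003.F_eq_form`). [cite: KrattenthalerZudilin2019, §2 (first display)] -/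
theorem catalanR_eq_form (n : ℕ) : catalanR n = (-1 : ℝ) ^ n * (8 * form n) := by
  rw [← F_eq_form, ← (hasSum_F' n).tsum_eq, ← tsum_mul_left, catalanR]
  refine tsum_congr fun t => ?_
  simp only [Zudilin2003.R]
  push_cast
  rw [prod_pow, pow_add]
  ring

end CatalanRTilde

open CatalanRTilde

/-- **Krattenthaler–Zudilin 2019, §2: "Amazingly, we have `r_n = r̃_n`"** — the named fact
`catalanR_eq_catalanRTilde` DISCHARGED: both families equal `(−1)ⁿ·8·(u_nG − v_n)` for Zudilin's 2003 recursion.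
[cite: KrattenthalerZudilin2019, §2 and Theorem 2] -/
theorem catalanR_eq_catalanRTilde_holds : catalanR_eq_catalanRTilde := fun n => by
  rw [catalanR_eq_form, catalanRTilde_eq_form]

/-- **Krattenthaler–Zudilin 2019, §2: `2^{4n} d_{2n−1}² r̃_n ∈ ℤ + ℤ·G`** — the named fact
`catalanRTilde_integrality` DISCHARGED (in print: "it is reasonably easy to show … using an argument similar to the
one in [Zu02b]", no proof given): from `r̃_n = (−1)ⁿ·8·(u_nG − v_n)` and the tree's PROVED inclusions
`2^{4n}u_n ∈ ℤ`, `2^{4n}D²_{2n−1}v_n ∈ ℤ` (`Zudilin2003.TwoAdic.zudilin_observation`).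
[cite: KrattenthalerZudilin2019, §2 (sentence after the second display)] -/
theorem catalanRTilde_integrality_holds : catalanRTilde_integrality := by
  intro n
  obtain ⟨⟨zu, hzu⟩, ⟨zv, hzv⟩⟩ := Zudilin2003.TwoAdic.zudilin_observation n
  have hu : ((zu : ℝ)) = 2 ^ (4 * n) * ((Zudilin2003.u n : ℚ) : ℝ) := by exact_mod_cast hzu
  have hv : ((zv : ℝ)) = 2 ^ (4 * n) * (Nat.lcmUpto (2 * n - 1) : ℝ) ^ 2 * ((Zudilin2003.v n : ℚ) : ℝ) := by
    exact_mod_cast hzv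
  refine ⟨-((-1) ^ n * 8 * zv), (-1) ^ n * 8 * ((Nat.lcmUpto (2 * n - 1) : ℕ) : ℤ) ^ 2 * zu, ?_⟩
  rw [catalanRTilde_eq_form, form]
  push_cast
  rw [hu, hv]
  ring

end Literature.NumberTheory.Irrationality.KrattenthalerZudilin2019
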